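import Mathlib
import Summits.Ventures.PercRepro2.UniversalBundleStep

/-! # Packages certified by their tables
(seat mine-b, cell pub-perc-repro2; MINE-B.md §25.12)

The hypotheses of `universal_ser_bundle` — an (UH*) assignment `f`, a red-up map `θ`, the (L1)
datum `g` — quantify over the configurations of `X`.  When the three maps are given by TABLES
(lists of pairs, looked up with `List.find?`), every hypothesis follows from list-level facts:
the keys cover the domain, each entry has the right target, and the values are `Nodup`
(`tableAssign_injective`, `tableAssign_spec`, `tableMap_inj`, `tableMap_spec`, `inD1_mem_d1List`).
The kernel then checks facts of size `|table|²` and `|cube| · |table|` instead of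
`|cube|² · |table|` — which is what makes bases with `2^{10}` configurations feasible under the
default heartbeat budget. -/

namespace Summit.Ventures.PercRepro2.UHClosure

open Finset

variable {X : Type*} [Preorder X] [Fintype X] [DecidableEq X]

section tables

variable (r b : X → ℕ)

/-- the assignment given by a table of (source, index, target) -/
def tableAssign (FT : List (X × ℕ × X)) (q : SlotL (USrc r b) b) : X :=
  match FT.find? (fun e => e.1 = q.1.1.1 ∧ e.2.1 = q.1.2.val) with
  | some e => e.2.2
  | none => q.1.1.1

/-- the map given by a table of (key, value), the identity off the keys -/
def tableMap (T : List (X × X)) (x : X) : X :=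
  match T.find? (fun e => e.1 = x) with
  | some e => e.2
  | none => x

omit [Preorder X] in
/-- the slots covered by the table: the looked-up entry exists, lies in the table and has the
slot's key -/
lemma tableAssign_find (FT : List (X × ℕ × X)) (q : SlotL (USrc r b) b)
    (hcover : ∃ e ∈ FT, e.1 = q.1.1.1 ∧ e.2.1 = q.1.2.val) :
    ∃ e ∈ FT, e.1 = q.1.1.1 ∧ e.2.1 = q.1.2.val ∧ tableAssign r b FT q = e.2.2 := by
  unfold tableAssign
  obtain ⟨e₀, he₀, hk₀⟩ := hcover
  cases h : FT.find? (fun e => e.1 = q.1.1.1 ∧ e.2.1 = q.1.2.val) with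
  | none =>
    exfalso
    have := List.find?_eq_none.1 h e₀ he₀
    simp only [decide_eq_true_eq] at this
    exact this hk₀
  | some e =>
    have hm := List.mem_of_find?_eq_some h
    have hp := List.find?_some h
    simp only [decide_eq_true_eq] at hp
    exact ⟨e, hm, hp.1, hp.2, rfl⟩

omit [Preorder X] [Fintype X] in
/-- the keys covered by a key-value table -/
lemma tableMap_find (T : List (X × X)) (x : X) (hcover : ∃ e ∈ T, e.1 = x) :
    ∃ e ∈ T, e.1 = x ∧ tableMap T x = e.2 := by
  unfold tableMap
  obtain ⟨e₀, he₀, hk₀⟩ := hcover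
  cases h : T.find? (fun e => e.1 = x) with
  | none =>
    exfalso
    have := List.find?_eq_none.1 h e₀ he₀
    simp only [decide_eq_true_eq] at this
    exact this hk₀
  | some e =>
    have hm := List.mem_of_find?_eq_some h
    have hp := List.find?_some h
    simp only [decide_eq_true_eq] at hp
    exact ⟨e, hm, hp, rfl⟩

omit [Preorder X] in
/-- **an (UH*) table with `Nodup` targets gives an injective assignment** -/
theorem tableAssign_injective (FT : List (X × ℕ × X))
    (hcover : ∀ q : SlotL (USrc r b) b, ∃ e ∈ FT, e.1 = q.1.1.1 ∧ e.2.1 = q.1.2.val)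
    (hnodup : (FT.map (fun e => e.2.2)).Nodup) : Function.Injective (tableAssign r b FT) := by
  intro q q' h
  obtain ⟨e, he, hk1, hk2, hv⟩ := tableAssign_find r b FT q (hcover q)
  obtain ⟨e', he', hk1', hk2', hv'⟩ := tableAssign_find r b FT q' (hcover q')
  have hee : e = e' := List.inj_on_of_nodup_map hnodup he he' (by rw [← hv, ← hv']; exact h)
  apply Subtype.ext; apply Prod.ext
  · exact Subtype.ext (by rw [← hk1, ← hk1', hee])
  · exact Fin.ext (by rw [← hk2, ← hk2', hee])

/-- **an (UH*) table whose entries have the right targets gives the (UH*) target properties** -/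
theorem tableAssign_spec (FT : List (X × ℕ × X))
    (hcover : ∀ q : SlotL (USrc r b) b, ∃ e ∈ FT, e.1 = q.1.1.1 ∧ e.2.1 = q.1.2.val)
    (hvals : ∀ e ∈ FT, e.2.2 ≤ e.1 ∧ r e.2.2 = 1 ∧ b e.1 ≤ b e.2.2 + 1) :
    ∀ q : SlotL (USrc r b) b, tableAssign r b FT q ≤ q.1.1.1 ∧ r (tableAssign r b FT q) = 1 ∧
      b q.1.1.1 ≤ b (tableAssign r b FT q) + 1 := by
  intro q
  obtain ⟨e, he, hk1, _, hv⟩ := tableAssign_find r b FT q (hcover q)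
  obtain ⟨h1, h2, h3⟩ := hvals e he
  rw [hv, ← hk1]
  exact ⟨h1, h2, h3⟩

omit [Preorder X] [Fintype X] in
/-- **a key-value table with `Nodup` values gives a map injective on the covered keys** -/
theorem tableMap_inj (T : List (X × X)) (P : X → Prop) (hcover : ∀ x, P x → ∃ e ∈ T, e.1 = x)
    (hnodup : (T.map (fun e => e.2)).Nodup) :
    ∀ x x', P x → P x' → tableMap T x = tableMap T x' → x = x' := by
  intro x x' hx hx' h
  obtain ⟨e, he, hk, hv⟩ := tableMap_find T x (hcover x hx)
  obtain ⟨e', he', hk', hv'⟩ := tableMap_find T x' (hcover x' hx')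
  have hee : e = e' := List.inj_on_of_nodup_map hnodup he he' (by rw [← hv, ← hv']; exact h)
  rw [← hk, ← hk', hee]

omit [Preorder X] [Fintype X] in
/-- **a key-value table whose entries satisfy a property gives the property on the covered keys** -/
theorem tableMap_spec (T : List (X × X)) (P : X → Prop) (Q : X → X → Prop)
    (hcover : ∀ x, P x → ∃ e ∈ T, e.1 = x) (hvals : ∀ e ∈ T, Q e.1 e.2) :
    ∀ x, P x → Q x (tableMap T x) := by
  intro x hx
  obtain ⟨e, he, hk, hv⟩ := tableMap_find T x (hcover x hx)
  rw [hv, ← hk]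
  exact hvals e he

/-- the blue-1 targets of the blue-1 sources, read off the (UH*) table -/
def d1List (FT : List (X × ℕ × X)) : List X :=
  (FT.filter (fun e => e.2.1 = 0 ∧ b e.1 = 1 ∧ b e.2.2 = 1)).map (fun e => e.2.2)

omit [Preorder X] in
/-- **the (L1) domain of a table assignment lies in `d1List`** -/
theorem inD1_mem_d1List (FT : List (X × ℕ × X))
    (hcover : ∀ q : SlotL (USrc r b) b, ∃ e ∈ FT, e.1 = q.1.1.1 ∧ e.2.1 = q.1.2.val) :
    ∀ x, InD1 r b (tableAssign r b FT) x → x ∈ d1List b FT := by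
  intro x ⟨_, hbx, q, hq0, hbq, hfq⟩
  obtain ⟨e, he, hk1, hk2, hv⟩ := tableAssign_find r b FT q (hcover q)
  unfold d1List
  rw [List.mem_map]
  refine ⟨e, ?_, by rw [← hv, hfq]⟩
  rw [List.mem_filter]
  refine ⟨he, ?_⟩
  simp only [decide_eq_true_eq]
  refine ⟨by rw [hk2, hq0], by rw [hk1, hbq], by rw [← hv, hfq, hbx]⟩

end tables

end Summit.Ventures.PercRepro2.UHClosure
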